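import Summits.AtomisticToContinuum.Crystallization.Theses.SquareWellLayerCake

/-!
# `StackingFaultSparsity` (stmt-AtomisticToContinuum-14296), negative side I: hcp windows are shell-paired

Negative-side support lemmas for the crux
`Summit.AtomisticToContinuum.Crystallization.Theses.SquareWellLayerCake.StackingFaultSparsity`
(= `…Theses.LaminarSixThreeThree.StackingFaultSparsity`, one shared proposition): for all `R > 0`,
`ε ∈ (0, 1/4)` and every sequence of Lennard-Jones ground states, the fraction of particles whose
`R`-window is `(R, ε)`-matched to SOME Barlow stacking but to NO `hcpStacking a h` tends to `0`.
Refuter's crux-disproof seat (cdisprove, 2026-08-16); part I of III (II: `BarlowWindow`, III: `DimerGas`).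

* §0 `WindowMatched` / `BarlowMatched` / `HcpMatched` — the matching predicates of the crux, verbatim,
  and `stackingFaultSparsity_iff` (`Iff.rfl`): the crux reads
  `∀ R ε …, ∀ GS-sequences, #{i : BarlowMatched ∧ ¬ HcpMatched}/N → 0`.
* §1 `hcp_twin` — for `z, p ∈ hcpStacking a h`, `p ≠ z`, there is a second point `p' ≠ p` of the
  stacking with `dist p' z = dist p z` (basal mirror through the layer of `z` for off-layer points —
  layers `k`, `2k₀ - k` carry the same letter in `ABAB…` —, in-layer inversion otherwise): punctured hcp
  windows carry a fixed-point-free distance-preserving involution.  Consequence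
  `not_hcpMatched_of_dimer`: a window consisting of its centre and ONE partner at distance `11/10`
  (nothing else within `10`) is matched to no relaxed hcp at `(R, ε) = (6/5, 1/100)`.
-/

noncomputable section

namespace Summit.AtomisticToContinuum.Crystallization.Theorems.StackingFaultSparsityNegative

open Literature.MathematicalPhysics.StatisticalMechanics

/-! ## §0. The crux, parametrised -/

/-- Ambient space `ℝ³`. [folklore] -/
abbrev E3 : Type := EuclideanSpace ℝ (Fin 3)

/-- Particle `i` of `X` has its `R`-window two-way `ε`-matched, after the affine isometry
`p ↦ X i + A (p - z)`, to the window of the model set `S` at `z` (the matching predicate of the crux,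
verbatim). [folklore] -/
def WindowMatched (R ε : ℝ) (S : Set E3) (z : E3) {N : ℕ} (X : Fin N → E3) (i : Fin N) : Prop :=
  ∃ A : E3 →ₗᵢ[ℝ] E3,
    (∀ p ∈ S, dist p z ≤ R → ∃ j : Fin N, dist (X j) (X i + A (p - z)) ≤ ε) ∧
    (∀ j : Fin N, dist (X j) (X i) ≤ R → ∃ p ∈ S, dist (X j) (X i + A (p - z)) ≤ ε)

/-- `(R, ε)`-matched to SOME Barlow stacking with `a, h ∈ (1/2, 2)` (first conjunct of the crux's
counted predicate, verbatim). [folklore] -/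
def BarlowMatched (R ε : ℝ) {N : ℕ} (X : Fin N → E3) (i : Fin N) : Prop :=
  ∃ a h : ℝ, 1 / 2 < a ∧ a < 2 ∧ 1 / 2 < h ∧ h < 2 ∧ ∃ s : ℤ → ℤ, IsHaggSeq s ∧
    ∃ z ∈ barlowStacking a h s, WindowMatched R ε (barlowStacking a h s) z X i

/-- `(R, ε)`-matched to SOME `hcpStacking a h`, `a, h ∈ (1/2, 2)` (negated second conjunct of the
crux's counted predicate, verbatim). [folklore] -/
def HcpMatched (R ε : ℝ) {N : ℕ} (X : Fin N → E3) (i : Fin N) : Prop :=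
  ∃ a h : ℝ, 1 / 2 < a ∧ a < 2 ∧ 1 / 2 < h ∧ h < 2 ∧
    ∃ z ∈ hcpStacking a h, WindowMatched R ε (hcpStacking a h) z X i

/-- The crux with the abbreviations, definitionally (`Iff.rfl`). [folklore] -/
theorem stackingFaultSparsity_iff :
    Summit.AtomisticToContinuum.Crystallization.Theses.SquareWellLayerCake.StackingFaultSparsity ↔
      ∀ R ε : ℝ, 0 < R → 0 < ε → ε < 1 / 4 → ∀ x : (N : ℕ) → (Fin N → E3),
        (∀ N, IsGroundState lennardJones (x N)) →
        Filter.Tendsto (fun N : ℕ =>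
          (Nat.card {i : Fin N // BarlowMatched R ε (x N) i ∧ ¬ HcpMatched R ε (x N) i} : ℝ) / N)
          Filter.atTop (nhds 0) :=
  Iff.rfl

/-- The shared item is literally one proposition in both route files. [folklore] -/
theorem stackingFaultSparsity_shared :
    Summit.AtomisticToContinuum.Crystallization.Theses.SquareWellLayerCake.StackingFaultSparsity ↔
      Summit.AtomisticToContinuum.Crystallization.Theses.LaminarSixThreeThree.StackingFaultSparsity :=
  Iff.rfl

/-! ## §1. hcp windows are shell-paired -/

/-- **Twin lemma.** In `hcpStacking a h` (`0 < a`, `h ≠ 0`), every point `p ≠ z` has a twin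
`p' ≠ p` in the stacking at the same distance from `z`: the basal mirror image through the layer of
`z` if `p` is off that layer (layers `k` and `2k₀ - k` carry the same letter in `ABAB…`), the in-layer
inversion `2z - p` otherwise. Hence punctured hcp windows carry a fixed-point-free distance-preserving
involution — the obstruction behind every "Barlow but not hcp" witness below. [new] -/
theorem hcp_twin {a h : ℝ} (ha : 0 < a) (hh : h ≠ 0) {z p : E3}
    (hz : z ∈ hcpStacking a h) (hp : p ∈ hcpStacking a h) (hpz : p ≠ z) :
    ∃ p' ∈ hcpStacking a h, p' ≠ p ∧ dist p' z = dist p z := by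
  obtain ⟨k₀, i₀, j₀, rfl⟩ := hz
  obtain ⟨k, i, j, rfl⟩ := hp
  by_cases hk : k = k₀
  · subst hk
    refine ⟨barlowPos a h alternatingHagg k (2 * i₀ - i) (2 * j₀ - j), barlowPos_mem _ _ _, ?_, ?_⟩
    · intro heq
      have hne : ((2 * i₀ - i, 2 * j₀ - j) : ℤ × ℤ) ≠ (i, j) := by
        intro h0
        simp only [Prod.mk.injEq] at h0
        obtain ⟨rfl, rfl⟩ : i = i₀ ∧ j = j₀ := ⟨by omega, by omega⟩
        exact hpz rfl
      have := le_dist_barlowPos_of_ne a h alternatingHagg (k := k) ha.le hne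
      rw [heq, dist_self] at this
      linarith
    · rw [← Real.sqrt_sq (dist_nonneg (x := barlowPos a h alternatingHagg k (2 * i₀ - i) (2 * j₀ - j))
        (y := barlowPos a h alternatingHagg k i₀ j₀)), ← Real.sqrt_sq (dist_nonneg
        (x := barlowPos a h alternatingHagg k i j) (y := barlowPos a h alternatingHagg k i₀ j₀)),
        dist_barlowPos_sq, dist_barlowPos_sq]
      congr 1
      push_cast
      ring
  · refine ⟨barlowPos a h alternatingHagg (2 * k₀ - k) i j, barlowPos_mem _ _ _, ?_, ?_⟩
    · intro heq
      have := congrArg (fun x : E3 => x 2) heq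
      simp only [barlowPos_apply_two] at this
      push_cast at this
      have : ((k₀ : ℝ) - k) * h = 0 := by linarith
      rcases mul_eq_zero.1 this with h1 | h1
      · exact hk (by exact_mod_cast (sub_eq_zero.1 h1).symm)
      · exact hh h1
    · have hL : haggLabel alternatingHagg (2 * k₀ - k) = haggLabel alternatingHagg k := by
        rw [haggLabel_alternating, haggLabel_alternating]
        have : Even (2 * k₀ - k) ↔ Even k := by
          rw [Int.even_sub]
          simp
        simp only [this]
      rw [← Real.sqrt_sq (dist_nonneg (x := barlowPos a h alternatingHagg (2 * k₀ - k) i j)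
        (y := barlowPos a h alternatingHagg k₀ i₀ j₀)), ← Real.sqrt_sq (dist_nonneg
        (x := barlowPos a h alternatingHagg k i j) (y := barlowPos a h alternatingHagg k₀ i₀ j₀)),
        dist_barlowPos_sq, dist_barlowPos_sq, hL]
      congr 1
      push_cast
      ring

/-- **Dimer windows are not hcp windows.** If the only particles within distance `10` of `X i` sit
at `X i` itself or at one partner site `X j₀` with `dist (X j₀) (X i) = 11/10`, then the `6/5`-window
of `i` is matched to no `hcpStacking a h`, `a, h ∈ (1/2, 2)`, at tolerance `1/100`: the partner's model
point has a twin at the same distance from the centre (`hcp_twin`), the particle within `1/100` of the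
twin's image can only be the partner again, and then two distinct stacking points are within `1/50`
of each other, against uniform discreteness `min a h > 1/2`. [new] -/
theorem not_hcpMatched_of_dimer {N : ℕ} (X : Fin N → E3) (i j₀ : Fin N)
    (hq : dist (X j₀) (X i) = 11 / 10)
    (hiso : ∀ j : Fin N, dist (X j) (X i) < 10 → X j = X i ∨ X j = X j₀) :
    ¬ HcpMatched (6 / 5) (1 / 100) X i := by
  rintro ⟨a, h, ha1, -, hh1, -, z, hz, A, h1, h2⟩
  obtain ⟨p, hp, hpd⟩ := h2 j₀ (by rw [hq]; norm_num)
  have hv : ‖A (p - z)‖ = dist p z := by rw [LinearIsometry.norm_map, dist_eq_norm]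
  have hv1 : dist (X i + A (p - z)) (X i) = dist p z := by
    rw [dist_eq_norm, add_sub_cancel_left, hv]
  have hpz_lo : 109 / 100 ≤ dist p z := by
    have := dist_triangle (X j₀) (X i + A (p - z)) (X i)
    linarith
  have hpz_hi : dist p z ≤ 111 / 100 := by
    have := dist_triangle (X i + A (p - z)) (X j₀) (X i)
    rw [dist_comm (X i + A (p - z)) (X j₀)] at this
    linarith
  have hpz : p ≠ z := by
    rintro rfl
    rw [dist_self] at hpz_lo
    linarith
  have ha0 : (0 : ℝ) < a := by linarith
  have hh0 : h ≠ 0 := by rintro rfl; linarith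
  obtain ⟨q, hqS, hne, hdist⟩ := hcp_twin ha0 hh0 hz hp hpz
  obtain ⟨j, hj⟩ := h1 q hqS (by rw [hdist]; linarith)
  have hw : ‖A (q - z)‖ = dist p z := by rw [LinearIsometry.norm_map, ← dist_eq_norm, hdist]
  have hw1 : dist (X i + A (q - z)) (X i) = dist p z := by
    rw [dist_eq_norm, add_sub_cancel_left, hw]
  have hjd : dist (X j) (X i) < 10 := by
    have := dist_triangle (X j) (X i + A (q - z)) (X i)
    linarith
  rcases hiso j hjd with hji | hjj
  · rw [hji, dist_comm] at hj
    linarith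
  · rw [hjj] at hj
    have hpq : dist p q ≤ 1 / 50 := by
      have h3 := dist_triangle (X i + A (p - z)) (X j₀) (X i + A (q - z))
      rw [dist_comm (X i + A (p - z)) (X j₀), dist_add_left, LinearIsometry.dist_map,
        dist_sub_right] at h3
      linarith
    have hmin := le_dist_of_mem_barlowStacking a h alternatingHagg ha0.le (by linarith) hp hqS hne.symm
    have : (1 : ℝ) / 2 < min a h := lt_min ha1 hh1
    linarith

end Summit.AtomisticToContinuum.Crystallization.Theorems.StackingFaultSparsityNegative

end
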